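import Summits.ResolutionOfSingularities.ResolutionOfSingularities.Theorems.HilbertSamuelEliminationSigmaMaxModificationsCorridor3Directrix214SharpDischarged
import Summits.ResolutionOfSingularities.ResolutionOfSingularities.Theorems.HilbertSamuelEliminationSigmaMaxModificationsCorridor3NormalDirectrixLine
import Summits.ResolutionOfSingularities.ResolutionOfSingularities.Theorems.HilbertSamuelEliminationSigmaMaxModificationsCorridor3NearFibreChart
import Summits.ResolutionOfSingularities.ResolutionOfSingularities.Theorems.HilbertSamuelEliminationSigmaMaxModificationsCorridor3WLadderStrataNearFibreGeomDir
import Literature.AlgebraicGeometry.Resolution.HironakaGroupSchemeCharZero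
import HarnessLib

/-!
# [OURS · L1 W4.2] 2.14♯ for an ARBITRARY permissible centre, NEAR-FIBRE (locus) form — base file: the data at `x`
# and the exports of a near point (for `…Corridor3Directrix214SharpNearFibre.lean`, which proves
# `theorem314_nearFibre_geomDir_of_facts`)

Cell res-hironaka, rung L, slot W4.2 (crux chain w42 `SigmaMaxModifications`, stmt-ResolutionOfSingularities-18506;
conjunct `SigmaMaxModificationsCorridor3`, stmt-ResolutionOfSingularities-19249), stub worker res-L1-w42-stub-3 (gen 4),
row `stub_Wlow3M_two` (β census `wlow3TwoM_census`, p520092) and its β-twin strata socket (stub-4,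
`…Corridor3WLadderStrataNearFibreGeomDir`, p517608). [OURS · L1 W4.2] new-combination; NOT a statement of any source,
and NOT a statement of H. Hironaka's 2017 manuscript.

CONTENT (the per-point half of the discharge of the (F1♯) near-fibre binder `Moving.Theorem314_nearFibre_geomDir` from
F-51′ `Hironaka1970_thmIV` + F-split `HerrmannIkedaOrbanz1988_cor_21_11`):

* `exists_minimal_generators_data` — at `x`: MINIMAL generators `g` of `I = I_{D,x}`, a lift `y` of a regular system of
  parameters of `𝒪_{D,x}`, `J_z = J_D · k[Z]` (F-split BY NAME) and `emb.dim = μ(I) + dim 𝒪_{D,x}` (T7b's kernel);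
* `directrixDim_normalCone_le_one` — `e_x(X) ≤ dim 𝒪_{D,x} + 1 ⇒ e(J_D) ≤ 1`;
* `directrixSpace_normalCone_le_chartPrime_of_near` — **at a near point `x'`, `𝒯(J_D) ⊆ 𝔭_{x'}`** («`x' ∈ ℙ(Dir(C_{X,D,x}))`»):
  the core of res-type-001's T7b `theorem314_geomDir_of_facts` (p516811) isolated, with the characteristic-`0` branch
  through res-D-lib-1's `HironakaScheme.directrixSpace_le_prime_of_charZero` (p519965) — so CJS Thm. 3.14 as printed is
  NOT a premise — and the positive-characteristic branch through T7's `directrixSpace_le_prime_of_facts` with F-52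
  `Hironaka1970_thm1_cor_holds` and F-50b `mizutani1973_vectorGroup_of_dim_le_of_hironaka` (both PROVED);
* `one_le_directrixDim_normalCone_of_near` — a near point forces `e(J_D) ≥ 1`;
* `near_point_chart_exports` — at a near point, with `e(J_D) = 1`: the exceptional ideal is generated by one section `c_j`
  of `D` and the ratios `c_k/c_j` are `k(x)`-rational (`…Corridor3NormalDirectrixLine`), read through `π^♯_{x'}`.

AI-written (res-L1-w42-stub-3 g4); AI review is weaker than expert review.
-/

set_option linter.dupNamespace false

noncomputable section

open CategoryTheory AlgebraicGeometry TopologicalSpace IsLocalRing MvPolynomial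
open Literature.AlgebraicGeometry.Resolution Literature.AlgebraicGeometry.Resolution.HironakaScheme
open Literature.RingTheory.HilbertSamuel Literature.RingTheory.MvPolynomial
open Literature.AlgebraicGeometry.CossartJannsenSaito2020
open Summit.ResolutionOfSingularities.KangarooAtlas.Mizutani
open Summit.ResolutionOfSingularities.ResolutionOfSingularities.Theorems.SigmaMaxModificationsCorridor3.Moving

namespace Summit.ResolutionOfSingularities.ResolutionOfSingularities.Theorems.SigmaMaxModificationsCorridor3.Directrix214Sharp

universe u

/-! ## At the point `x`: minimal generators of `I_{D,x}` and the numerics of F-split -/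

/-- **The data at `x`.** For `A = 𝒪_{X,x}` noetherian local and `I = I_{D,x}` permissible, F-split (HIO Cor. (21.11))
taken BY NAME yields: MINIMAL generators `g_0, …, g_n` of `I` (`μ(I) = n + 1 ≥ 1` since `I` lies in no minimal prime), a lift
`y` of a regular system of parameters of `A/I` (`dim A/I = s`) with `(g, y)` generating `𝔪`, the Hironaka–Grothendieck
equality `J_{(g,y)} = J_D · k[Z]`, and `emb.dim A = (n + 1) + s` (T7b's kernel, `spanFinrank_maximalIdeal_eq_of_tangentConeIdeal_eq`).
[OURS · L1 W4.2; AI-written] -/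
theorem exists_minimal_generators_data (hsplit : HerrmannIkedaOrbanz1988_cor_21_11.{u})
    {A : Type u} [CommRing A] [IsLocalRing A] [IsNoetherianRing A] {I : Ideal A} (hI : I.IsPermissible) :
    ∃ (n s : ℕ) (g : Fin (n + 1) → A) (y : Fin s → A)
      (hz : Ideal.span (Set.range (Fin.append g y)) = maximalIdeal A),
      Ideal.span (Set.range g) = I ∧ I.spanFinrank = n + 1 ∧ ringKrullDim (A ⧸ I) = (s : WithBot ℕ∞) ∧
      (maximalIdeal A).spanFinrank = (n + 1) + s ∧
      tangentConeIdeal (Fin.append g y) hz = (normalConeIdeal g).map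
        ((rename (Fin.castAdd s) : MvPolynomial (Fin (n + 1)) (ResidueField A) →ₐ[ResidueField A]
          MvPolynomial (Fin ((n + 1) + s)) (ResidueField A)) :
          MvPolynomial (Fin (n + 1)) (ResidueField A) →+* MvPolynomial (Fin ((n + 1) + s)) (ResidueField A)) := by
  classical
  haveI hreg : IsRegularLocalRing (A ⧸ I) := hI.isRegularLocalRing
  -- minimal generators of `I`; `μ(I) ≥ 1` since `I` lies in no minimal prime
  obtain ⟨g₀, hg₀⟩ := exists_fun_span_eq_of_fg (I := I) (IsNoetherian.noetherian I)
  have hmpos : 0 < I.spanFinrank := by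
    by_contra h0
    have h0' : I.spanFinrank = 0 := by omega
    have hIbot : I = ⊥ := by
      rw [← hg₀, Ideal.span_eq_bot]
      rintro _ ⟨i, rfl⟩
      exact Fin.elim0 (Fin.cast h0' i)
    obtain ⟨q, hq, -⟩ := Ideal.exists_minimalPrimes_le (I := (⊥ : Ideal A)) (J := maximalIdeal A) bot_le
    exact hI.not_le_of_mem_minimalPrimes hq (hIbot ▸ bot_le)
  obtain ⟨n, hn⟩ : ∃ n, I.spanFinrank = n + 1 := ⟨_, (Nat.succ_pred_eq_of_pos hmpos).symm⟩
  set g : Fin (n + 1) → A := g₀ ∘ Fin.cast hn.symm with hg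
  have hgI : Ideal.span (Set.range g) = I := by
    have hsurj : Function.Surjective (Fin.cast hn.symm) := fun i => ⟨Fin.cast hn i, by simp⟩
    rw [hg, hsurj.range_comp]
    exact hg₀
  have hm : (Ideal.span (Set.range g)).spanFinrank = n + 1 := by rw [hgI, hn]
  -- a lift `y` of a regular system of parameters of `A ⧸ I`
  set s := (maximalIdeal (A ⧸ I)).spanFinrank with hs
  have hdimI : ringKrullDim (A ⧸ I) = (s : WithBot ℕ∞) := hreg.spanFinrank_maximalIdeal.symm
  obtain ⟨ybar, hybar⟩ := exists_span_range_eq_maximalIdeal (A ⧸ I) (e := s) le_rfl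
  have hy' : ∀ i, ∃ yi : A, Ideal.Quotient.mk I yi = ybar i := fun i => Ideal.Quotient.mk_surjective (ybar i)
  choose y hy using hy'
  have hz : Ideal.span (Set.range (Fin.append g y)) = maximalIdeal A := by
    have hcomap : (maximalIdeal (A ⧸ I)).comap (Ideal.Quotient.mk I) = maximalIdeal A :=
      IsLocalRing.eq_maximalIdeal
        (Ideal.comap_isMaximal_of_surjective _ Ideal.Quotient.mk_surjective)
    have hybar' : Ideal.span (Set.range ybar) = (Ideal.span (Set.range y)).map (Ideal.Quotient.mk I) := by
      have hfun : ybar = (Ideal.Quotient.mk I) ∘ y := funext fun i => (hy i).symm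
      rw [Ideal.map_span, ← Set.range_comp, hfun]
    rw [range_fin_append, Ideal.span_union, hgI, ← hcomap, ← hybar, hybar',
      Ideal.comap_map_of_surjective _ Ideal.Quotient.mk_surjective]
    rw [sup_comm]
    congr 1
    exact (Ideal.mk_ker (I := I)).symm
  -- F-split: `J_z = J_D · k[Z]`, hence `z` is a minimal system of generators of `𝔪`
  have hJz := hsplit A I (n + 1) s g y hz hgI hreg hI.isNormallyFlat hdimI
  have hE : (maximalIdeal A).spanFinrank = (n + 1) + s :=
    spanFinrank_maximalIdeal_eq_of_tangentConeIdeal_eq hm hz hJz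
  exact ⟨n, s, g, y, hz, hgI, hn, hdimI, hE, hJz⟩

/-- **Numerics: `e_x(X) ≤ dim 𝒪_{D,x} + 1 ⇒ e(J_D) ≤ 1`** (from `J_z = J_D · k[Z]`: `e_x(X) = e(J_z) ≥ e(J_D) + dim 𝒪_{D,x}`).
[OURS · L1 W4.2; AI-written] -/
theorem directrixDim_normalCone_le_one {A : Type u} [CommRing A] [IsLocalRing A] [IsNoetherianRing A] {I : Ideal A}
    {n s : ℕ} {g : Fin (n + 1) → A} {y : Fin s → A} {hz : Ideal.span (Set.range (Fin.append g y)) = maximalIdeal A}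
    (hdimI : ringKrullDim (A ⧸ I) = (s : WithBot ℕ∞)) (hE : (maximalIdeal A).spanFinrank = (n + 1) + s)
    (hJz : tangentConeIdeal (Fin.append g y) hz = (normalConeIdeal g).map
        ((rename (Fin.castAdd s) : MvPolynomial (Fin (n + 1)) (ResidueField A) →ₐ[ResidueField A]
          MvPolynomial (Fin ((n + 1) + s)) (ResidueField A)) :
          MvPolynomial (Fin (n + 1)) (ResidueField A) →+* MvPolynomial (Fin ((n + 1) + s)) (ResidueField A)))
    (he : (dirDim A : WithBot ℕ∞) ≤ ringKrullDim (A ⧸ I) + 1) : directrixDim (normalConeIdeal g) ≤ 1 := by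
  have hdirDim : dirDim A = directrixDim (tangentConeIdeal (Fin.append g y) hz) := dirDim_eq' A hE (Fin.append g y) hz
  have h1 := directrixDim_add_le_directrixDim_map_rename s (normalConeIdeal g)
  rw [← hJz, ← hdirDim] at h1
  rw [hdimI] at he
  have he' : dirDim A ≤ s + 1 := by
    have h2 : ((dirDim A : ℕ) : WithBot ℕ∞) ≤ ((s + 1 : ℕ) : WithBot ℕ∞) := by
      rw [Nat.cast_add, Nat.cast_one]; exact he
    exact_mod_cast h2
  omega

/-! ## At a near point `x'`: the normal directrix space lies in the prime `𝔭_{x'}` (F-51′ + Hironaka–Mizutani) -/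

/-- **2.14♯ at a near point, general centre, DIRECTRIX-SPACE form** (the core of T7b `theorem314_geomDir_of_facts`,
isolated): for `X` excellent, `D` permissible, `π` the blow-up in `D`, `x'` over `x = π(x')` near to it with (F1♯)
`char k(x) = 0 ∨ ē_x(X) + 2 ≤ 2·char k(x)`, minimal generators `g` of `I_{D,x}` with a lift `y` of a regular system of
parameters of `𝒪_{D,x}` and `J_z = J_D · k[Z]`, and a chart `(t, u)` of the exceptional divisor at `x'`
(`I_{D,x}𝒪_{X',x'} = (t)`, `π^♯(g_i) = u_i t`): every linear form of the directrix space `𝒯(J_D)` lies in the homogeneous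
prime `𝔭_{x'}` of `x'` («`x' ∈ ℙ(Dir(C_{X,D,x})) = ℙ(Dir_x(X)/T_x(D))`»). F-51′ BY NAME; char `0` through
`directrixSpace_le_prime_of_charZero`, char `p` through T7's `directrixSpace_le_prime_of_facts` with F-52/F-50b PROVED.
[OURS · L1 W4.2] new-combination; NOT a statement of any source; AI-written. -/
theorem directrixSpace_normalCone_le_chartPrime_of_near (h51 : Hironaka1970_thmIV.{u})
    {X X' : Scheme.{u}} [IsLocallyNoetherian X] {π : X' ⟶ X} {D : X.IdealSheafData} {N : ℕ}
    (hexc : Scheme.IsExcellent X) (hperm : IdealSheafData.IsPermissible D) (hπ : IsBlowup π D)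
    (hdim : topologicalKrullDim X ≤ (N : WithBot ℕ∞)) {x' : X'} (hxD : π.base x' ∈ (D.support : Set X))
    (hgeo : GeomDirHypothesis X (π.base x'))
    {n s : ℕ} {g : Fin (n + 1) → X.presheaf.stalk (π.base x')} {y : Fin s → X.presheaf.stalk (π.base x')}
    (hgI : Ideal.span (Set.range g) = stalkIdeal D (π.base x')) (hn : (stalkIdeal D (π.base x')).spanFinrank = n + 1)
    {hz : Ideal.span (Set.range (Fin.append g y)) = maximalIdeal (X.presheaf.stalk (π.base x'))}
    (hE : (maximalIdeal (X.presheaf.stalk (π.base x'))).spanFinrank = (n + 1) + s)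
    (hJz : tangentConeIdeal (Fin.append g y) hz = (normalConeIdeal g).map
        ((rename (Fin.castAdd s) : MvPolynomial (Fin (n + 1)) (ResidueField (X.presheaf.stalk (π.base x')))
          →ₐ[ResidueField (X.presheaf.stalk (π.base x'))]
          MvPolynomial (Fin ((n + 1) + s)) (ResidueField (X.presheaf.stalk (π.base x')))) :
          MvPolynomial (Fin (n + 1)) (ResidueField (X.presheaf.stalk (π.base x'))) →+*
            MvPolynomial (Fin ((n + 1) + s)) (ResidueField (X.presheaf.stalk (π.base x')))))
    {t : X'.presheaf.stalk x'} {u : Fin (n + 1) → X'.presheaf.stalk x'}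
    (ht : t ∈ nonZeroDivisors (X'.presheaf.stalk x'))
    (hmap : (stalkIdeal D (π.base x')).map (π.stalkMap x').hom = Ideal.span {t})
    (hu : ∀ i, (π.stalkMap x').hom (g i) = u i * t)
    (hnear : Scheme.hsFun X' N x' = Scheme.hsFun X N (π.base x')) :
    ∀ L ∈ directrixSpace (normalConeIdeal g), L ∈ chartPrime (π.stalkMap x').hom u := by
  classical
  haveI : IsLocalHom (π.stalkMap x').hom := π.toLRSHom.prop x'
  -- F-51′: `J_D` is generated inside `U(𝔭_{x'})`
  have h51' : normalConeIdeal g ≤ Ideal.span ((normalConeIdeal g :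
      Set (MvPolynomial (Fin (n + 1)) (ResidueField (X.presheaf.stalk (π.base x'))))) ∩
      (multAlgebra (ResidueField (X.presheaf.stalk (π.base x'))) (chartPrime (π.stalkMap x').hom u) :
        Set (MvPolynomial (Fin (n + 1)) (ResidueField (X.presheaf.stalk (π.base x')))))) :=
    h51 X X' π D N x' (π.base x') hexc hperm hπ hdim rfl hxD hnear (n + 1) g t u hgI hn ht hmap hu
  -- `𝔭_{x'}` is a point of `ℙ(N_{D,x})`
  haveI h𝔭prime : (chartPrime (π.stalkMap x').hom u).IsPrime := isPrime_chartPrime _ u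
  obtain ⟨i₀, hi₀⟩ := exists_X_not_mem_chartPrime_of_map_eq (π.stalkMap x').hom hgI ht hmap hu
  intro L hL
  by_cases hc0 : ringChar (ResidueField (X.presheaf.stalk (π.base x'))) = 0
  · -- characteristic `0`: `U(𝔭)` is generated by linear forms
    haveI : CharP (ResidueField (X.presheaf.stalk (π.base x'))) 0 := hc0 ▸ ringChar.charP _
    haveI : CharZero (ResidueField (X.presheaf.stalk (π.base x'))) := CharP.charP_to_charZero _
    exact directrixSpace_le_prime_of_charZero h51' hL
  · -- positive characteristic `p`, `ē(J_D) + 2 ≤ ē_x(X) + 2 ≤ 2p`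
    have hgeom : Scheme.geomDirDim X (π.base x') + 2 ≤ 2 * ringChar (ResidueField (X.presheaf.stalk (π.base x'))) :=
      hgeo.resolve_left hc0
    obtain ⟨p, hp⟩ : ∃ p, ringChar (ResidueField (X.presheaf.stalk (π.base x'))) = p := ⟨_, rfl⟩
    rw [hp] at hc0 hgeom
    haveI : CharP (ResidueField (X.presheaf.stalk (π.base x'))) p := hp ▸ ringChar.charP _
    haveI hpp : Fact p.Prime := ⟨CharP.char_prime_of_ne_zero (ResidueField (X.presheaf.stalk (π.base x'))) hc0⟩
    have hpt : IsPoint (ResidueField (X.presheaf.stalk (π.base x'))) (chartPrime (π.stalkMap x').hom u) := by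
      refine ⟨isPrime_chartPrime _ u, fun f hf d => homogeneousComponent_mem_chartPrime _ u hf d, ?_⟩
      intro hle
      exact hi₀ (hle (by simp [irrelevant]))
    haveI : PerfectRing (AlgebraicClosure (ResidueField (X.presheaf.stalk (π.base x')))) p :=
      PerfectField.toPerfectRing p
    have hgeomA : Scheme.geomDirDim X (π.base x') = directrixDim ((tangentConeIdeal (Fin.append g y) hz).map
        (MvPolynomial.map (algebraMap (ResidueField (X.presheaf.stalk (π.base x')))
          (AlgebraicClosure (ResidueField (X.presheaf.stalk (π.base x'))))))) :=
      dirDimOver_eq' (X.presheaf.stalk (π.base x')) _ hE (Fin.append g y) hz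
    have hdir : directrixDim ((normalConeIdeal g).map (MvPolynomial.map
        (algebraMap (ResidueField (X.presheaf.stalk (π.base x')))
          (AlgebraicClosure (ResidueField (X.presheaf.stalk (π.base x'))))))) + 2 ≤ 2 * p := by
      have h1 := directrixDim_add_le_directrixDim_map_rename s ((normalConeIdeal g).map (MvPolynomial.map
        (algebraMap (ResidueField (X.presheaf.stalk (π.base x')))
          (AlgebraicClosure (ResidueField (X.presheaf.stalk (π.base x')))))))
      rw [← map_map_rename_eq, ← hJz, ← hgeomA] at h1
      omega
    exact directrixSpace_le_prime_of_facts p _ (Hironaka1970_thm1_cor_holds p)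
      (mizutani1973_vectorGroup_of_dim_le_of_hironaka p (Hironaka1970_thm1_cor_holds p)) hpt h51' hdir hL

/-- **A near point forces `e(J_D) ≥ 1`** (the prime `𝔭_{x'}` contains `𝒯(J_D)` and misses a variable).
[OURS · L1 W4.2; AI-written] -/
theorem one_le_directrixDim_normalCone_of_near (h51 : Hironaka1970_thmIV.{u})
    {X X' : Scheme.{u}} [IsLocallyNoetherian X] {π : X' ⟶ X} {D : X.IdealSheafData} {N : ℕ}
    (hexc : Scheme.IsExcellent X) (hperm : IdealSheafData.IsPermissible D) (hπ : IsBlowup π D)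
    (hdim : topologicalKrullDim X ≤ (N : WithBot ℕ∞)) {x' : X'} (hxD : π.base x' ∈ (D.support : Set X))
    (hgeo : GeomDirHypothesis X (π.base x'))
    {n s : ℕ} {g : Fin (n + 1) → X.presheaf.stalk (π.base x')} {y : Fin s → X.presheaf.stalk (π.base x')}
    (hgI : Ideal.span (Set.range g) = stalkIdeal D (π.base x')) (hn : (stalkIdeal D (π.base x')).spanFinrank = n + 1)
    {hz : Ideal.span (Set.range (Fin.append g y)) = maximalIdeal (X.presheaf.stalk (π.base x'))}
    (hE : (maximalIdeal (X.presheaf.stalk (π.base x'))).spanFinrank = (n + 1) + s)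
    (hJz : tangentConeIdeal (Fin.append g y) hz = (normalConeIdeal g).map
        ((rename (Fin.castAdd s) : MvPolynomial (Fin (n + 1)) (ResidueField (X.presheaf.stalk (π.base x')))
          →ₐ[ResidueField (X.presheaf.stalk (π.base x'))]
          MvPolynomial (Fin ((n + 1) + s)) (ResidueField (X.presheaf.stalk (π.base x')))) :
          MvPolynomial (Fin (n + 1)) (ResidueField (X.presheaf.stalk (π.base x'))) →+*
            MvPolynomial (Fin ((n + 1) + s)) (ResidueField (X.presheaf.stalk (π.base x')))))
    (hnear : Scheme.hsFun X' N x' = Scheme.hsFun X N (π.base x')) :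
    1 ≤ directrixDim (normalConeIdeal g) := by
  haveI : IsLocalHom (π.stalkMap x').hom := π.toLRSHom.prop x'
  obtain ⟨t, ht, hspan⟩ := hπ.isEffectiveCartier.exists_stalkIdeal_eq_span x'
  have hmap : (stalkIdeal D (π.base x')).map (π.stalkMap x').hom = Ideal.span {t} := by
    rw [← hspan, stalkIdeal_comap_eq_map_stalkMap]
  have hu : ∀ i, ∃ ui : X'.presheaf.stalk x', (π.stalkMap x').hom (g i) = ui * t := by
    intro i
    have hmem : (π.stalkMap x').hom (g i) ∈ (stalkIdeal D (π.base x')).map (π.stalkMap x').hom := by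
      refine Ideal.mem_map_of_mem _ ?_
      rw [← hgI]
      exact Ideal.subset_span ⟨i, rfl⟩
    rw [hmap, Ideal.mem_span_singleton'] at hmem
    obtain ⟨ui, hui⟩ := hmem
    exact ⟨ui, hui.symm⟩
  choose u hu using hu
  have hcore := directrixSpace_normalCone_le_chartPrime_of_near h51 hexc hperm hπ hdim hxD hgeo hgI hn hE hJz
    ht hmap hu hnear
  obtain ⟨i₀, hi₀⟩ := exists_X_not_mem_chartPrime_of_map_eq (π.stalkMap x').hom hgI ht hmap hu
  exact one_le_directrixDim_of_not_mem ((mem_homogeneousSubmodule 1 _).mpr (isHomogeneous_X _ i₀))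
    fun h => hi₀ (hcore _ h)

/-! ## At a near point `x'`: the chart section `c_j` and the `k(x)`-rational ratios, read through `π^♯_{x'}` -/

/-- **The exports of a near point** for the chart argument (general centre, `e(J_D) = 1`): at a point `x'` over `x`
near to `x` (hypotheses as in `directrixSpace_normalCone_le_chartPrime_of_near`, phrased at `x` with `h : π x' = x`),
for sections `c` of `D` over an affine `U ∋ x`, a section `c_j` whose germ `Σ a_i g_i` has symbol off the hyperplane
`𝒯(J_D)`, and ratios `β_k ∈ 𝒪_{X,x}` valid in every chart containing `𝒯(J_D)` in its prime
(`…NormalDirectrixLine.exists_forall_sub_mul_mem_normalCone`): (1) the exceptional ideal `(D·𝒪_{X'})_{x'}` is generated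
by `π^♯(c_j)`; (2) there is a ring map `φ : 𝒪_{X,x} → 𝒪_{X',x'}` over `π^♯ ∘ germ`, with values in the image of `π^♯_{x'}`,
in which `c_k ≡ β_k c_j` modulo `(c_j)·𝔪_{x'}`. [OURS · L1 W4.2; AI-written] -/
theorem near_point_chart_exports (h51 : Hironaka1970_thmIV.{u})
    {X X' : Scheme.{u}} [IsLocallyNoetherian X] {π : X' ⟶ X} {D : X.IdealSheafData} {N : ℕ}
    (hexc : Scheme.IsExcellent X) (hperm : IdealSheafData.IsPermissible D) (hπ : IsBlowup π D)
    (hdim : topologicalKrullDim X ≤ (N : WithBot ℕ∞))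
    (U : X.affineOpens) {x : X} (hxU : x ∈ (U : X.Opens)) [Algebra Γ(X, U) (X.presheaf.stalk x)]
    (halg : ∀ s : Γ(X, U), algebraMap Γ(X, U) (X.presheaf.stalk x) s = (X.presheaf.germ U x hxU).hom s)
    (hxD : x ∈ (D.support : Set X)) (hgeo : GeomDirHypothesis X x)
    {n s r : ℕ} {g : Fin (n + 1) → X.presheaf.stalk x} {y : Fin s → X.presheaf.stalk x}
    (hgI : Ideal.span (Set.range g) = stalkIdeal D x) (hn : (stalkIdeal D x).spanFinrank = n + 1)
    {hz : Ideal.span (Set.range (Fin.append g y)) = maximalIdeal (X.presheaf.stalk x)}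
    (hE : (maximalIdeal (X.presheaf.stalk x)).spanFinrank = (n + 1) + s)
    (hJz : tangentConeIdeal (Fin.append g y) hz = (normalConeIdeal g).map
        ((rename (Fin.castAdd s) : MvPolynomial (Fin (n + 1)) (ResidueField (X.presheaf.stalk x))
          →ₐ[ResidueField (X.presheaf.stalk x)] MvPolynomial (Fin ((n + 1) + s)) (ResidueField (X.presheaf.stalk x))) :
          MvPolynomial (Fin (n + 1)) (ResidueField (X.presheaf.stalk x)) →+*
            MvPolynomial (Fin ((n + 1) + s)) (ResidueField (X.presheaf.stalk x))))
    (hd : directrixDim (normalConeIdeal g) = 1)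
    {c : Fin r → Γ(X, U)} (j : Fin r) {a : Fin (n + 1) → X.presheaf.stalk x}
    (hta : algebraMap Γ(X, U) (X.presheaf.stalk x) (c j) = ∑ i, a i * g i)
    (hℓ : linForm (fun i => residue (X.presheaf.stalk x) (a i)) ∉ directrixSpace (normalConeIdeal g))
    (β : Fin r → X.presheaf.stalk x)
    (hβ : ∀ (k : Fin r) (B : Type u) [CommRing B] [IsLocalRing B] (φ : X.presheaf.stalk x →+* B) [IsLocalHom φ]
      (t : B) (u : Fin (n + 1) → B),
      (Ideal.span (Set.range g)).map φ = Ideal.span {t} → (∀ i, φ (g i) = u i * t) →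
      (∀ L ∈ directrixSpace (normalConeIdeal g), L ∈ chartPrime φ u) →
        φ (algebraMap Γ(X, U) (X.presheaf.stalk x) (c k)) -
            φ (β k) * φ (algebraMap Γ(X, U) (X.presheaf.stalk x) (c j)) ∈
          Ideal.span {φ (algebraMap Γ(X, U) (X.presheaf.stalk x) (c j))} * maximalIdeal B)
    {x' : X'} (hx : π.base x' = x) (hx'U : π x' ∈ (U : X.Opens))
    (hnear : Scheme.hsFun X' N x' = Scheme.hsFun X N x) :
    stalkIdeal (D.comap π) x' = Ideal.span {(π.stalkMap x').hom ((X.presheaf.germ U (π x') hx'U).hom (c j))} ∧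
    ∃ φ : X.presheaf.stalk x →+* X'.presheaf.stalk x',
      (∀ s : Γ(X, U), φ (algebraMap Γ(X, U) (X.presheaf.stalk x) s) =
        (π.stalkMap x').hom ((X.presheaf.germ U (π x') hx'U).hom s)) ∧
      (∀ k, φ (algebraMap Γ(X, U) (X.presheaf.stalk x) (c k)) -
            φ (β k) * φ (algebraMap Γ(X, U) (X.presheaf.stalk x) (c j)) ∈
          Ideal.span {φ (algebraMap Γ(X, U) (X.presheaf.stalk x) (c j))} *
            maximalIdeal (X'.presheaf.stalk x')) ∧
      ∀ a₀ : X.presheaf.stalk x, ∃ a' : X.presheaf.stalk (π x'), (π.stalkMap x').hom a' = φ a₀ := by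
  subst hx
  haveI : IsLocalHom (π.stalkMap x').hom := π.toLRSHom.prop x'
  -- the chart of the exceptional divisor at `x'`
  obtain ⟨t, ht, hspan⟩ := hπ.isEffectiveCartier.exists_stalkIdeal_eq_span x'
  have hmap : (stalkIdeal D (π.base x')).map (π.stalkMap x').hom = Ideal.span {t} := by
    rw [← hspan, stalkIdeal_comap_eq_map_stalkMap]
  have hu : ∀ i, ∃ ui : X'.presheaf.stalk x', (π.stalkMap x').hom (g i) = ui * t := by
    intro i
    have hmem : (π.stalkMap x').hom (g i) ∈ (stalkIdeal D (π.base x')).map (π.stalkMap x').hom := by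
      refine Ideal.mem_map_of_mem _ ?_
      rw [← hgI]
      exact Ideal.subset_span ⟨i, rfl⟩
    rw [hmap, Ideal.mem_span_singleton'] at hmem
    obtain ⟨ui, hui⟩ := hmem
    exact ⟨ui, hui.symm⟩
  choose u hu using hu
  -- the directrix space lies in `𝔭_{x'}`
  have hcore := directrixSpace_normalCone_le_chartPrime_of_near h51 hexc hperm hπ hdim hxD hgeo hgI hn hE hJz
    ht hmap hu hnear
  have hmap' : (Ideal.span (Set.range g)).map (π.stalkMap x').hom = Ideal.span {t} := by rw [hgI, hmap]
  -- (1) the exceptional ideal is generated by `π^♯(c_j)`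
  have hgen : (Ideal.span (Set.range g)).map (π.stalkMap x').hom =
      Ideal.span {(π.stalkMap x').hom (algebraMap Γ(X, U) (X.presheaf.stalk (π.base x')) (c j))} :=
    map_span_eq_span_of_normalCone hd hta hℓ (π.stalkMap x').hom hmap' hu hcore
  refine ⟨?_, (π.stalkMap x').hom, fun sec => ?_, fun k => ?_, fun a₀ => ⟨a₀, rfl⟩⟩
  · rw [stalkIdeal_comap_eq_map_stalkMap, ← hgI, hgen, halg]
  · exact congrArg _ (halg sec)
  · exact hβ k _ (π.stalkMap x').hom t u hmap' hu hcore

end Summit.ResolutionOfSingularities.ResolutionOfSingularities.Theorems.SigmaMaxModificationsCorridor3.Directrix214Sharp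

end
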